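import Summits.QuantumAdvantage.QuantumAdvantage.Theorems.WbwObfuscatedGluedTreesKowBbVocabulary

/-!
# `WbwObfuscatedGluedTrees` (stmt-QuantumAdvantage-2340) — line `knowledge-of-walk-split`, STAGE 5:
# injective functions are the embeddings (`stub_funToEmb`)

Pure finite combinatorics for the black-box soundness chain of stage 5: the passage from uniformly random
FUNCTION namings `V(G'_d) → {0,1}^N` (where collision counting is easy) to uniformly random INJECTIVE namings
(the embeddings `NamingN d N = V(G'_d) ↪ {0,1}^N`, sample space `OutcomeN d N = CycleDatum d × NamingN d N`).
Counting an event of embeddings over all (cycle datum, function) pairs — the event being "the function is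
injective and the corresponding embedding lies in the event", false on non-injective functions — gives the same
count as over the outcomes, and there are at least as many (cycle datum, function) pairs as outcomes.

[folklore] elementary counting; no citation content.
-/

set_option linter.dupNamespace false

namespace Summit.QuantumAdvantage.QuantumAdvantage.Theorems.WbwObfuscatedGluedTrees.KnowledgeOfWalk.BlackBox

open Literature.Computability.Complexity Literature.Computability.QuantumComplexity
open Literature.Computability.QuantumComplexity.GluedTrees
open Literature.Computability.Cryptography Literature.Computability.Cryptography.ObfuscatedGluedTrees

/-- **Injective functions are the embeddings.** For every event `E` of (cycle datum, injective `N`-bit naming)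
pairs, the number of (cycle datum, FUNCTION naming) pairs whose function is injective and whose corresponding
embedding lies in `E` equals the number of outcomes in `E` (the map `(σ, ν) ↦ (σ, ⇑ν)` is a bijection onto the
former set), and the outcome space `OutcomeN d N` is no larger than `CycleDatum d × (V(G'_d) → {0,1}^N)` (the same
map is injective). [folklore] -/
theorem stub_funToEmb : ∀ (d N : ℕ) (E : CycleDatum d → NamingN d N → Prop) [∀ σ, DecidablePred (E σ)],
    (Finset.univ.filter fun ω : CycleDatum d × (Vertex d → (Fin N → Bool)) =>
        ∃ h : Function.Injective ω.2, E ω.1 ⟨ω.2, h⟩).card =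
      (Finset.univ.filter fun ω : OutcomeN d N => E ω.1 ω.2).card ∧
    Fintype.card (OutcomeN d N) ≤ Fintype.card (CycleDatum d × (Vertex d → (Fin N → Bool))) := by
  intro d N E _
  refine ⟨?_, ?_⟩
  · symm
    refine Finset.card_bij (fun b _ => (b.1, ⇑b.2)) ?_ ?_ ?_
    · intro b hb
      simp only [Finset.mem_filter, Finset.mem_univ, true_and] at hb ⊢
      exact ⟨b.2.injective, hb⟩
    · intro b₁ _ b₂ _ h
      simp only [Prod.mk.injEq] at h
      exact Prod.ext h.1 (DFunLike.coe_injective h.2)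
    · intro a ha
      simp only [Finset.mem_filter, Finset.mem_univ, true_and] at ha
      obtain ⟨h, hE⟩ := ha
      exact ⟨(a.1, ⟨a.2, h⟩), by simpa using hE, rfl⟩
  · exact Fintype.card_le_of_injective (fun ω : OutcomeN d N => (ω.1, ⇑ω.2))
      fun ω₁ ω₂ h => Prod.ext (Prod.mk.inj h).1 (DFunLike.coe_injective (Prod.mk.inj h).2)

end Summit.QuantumAdvantage.QuantumAdvantage.Theorems.WbwObfuscatedGluedTrees.KnowledgeOfWalk.BlackBox
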